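import Summits.CriticalPhenomena.PercolationContinuityZ3.Theorems.PercNearOneGluingAdditiveGluingFingerPeel
import HarnessLib

/-! # Crux `PercNearOneGluing.AdditiveGluing` (stmt-CriticalPhenomena-4576) — the finger multi-edge Lemma 3 (`stub_fingerML3_vp`):
# peeling the bundle at one relay under the GLUED comparison (seat (b) V⁺-form, depth prover `png-dp-vplus`, gen 9)

Support file (`--supports stmt-CriticalPhenomena-4576`); no definitions, no named facts, no sorries.  Companion of
`…AdditiveGluingFingerPeel.lean` (`fingerML3_peel`: the same peeling step under the UNGLUED comparison `μ_K(d↔b) ≤ μ_K(a↔b)`).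

The peeling identity behind `fingerML3_peel` / `block_multiEdge_peel` is `margin_K(d) = TB(K,a) + ψ_a · margin_{K ⊖ (N–a)}(d)` with
`TB(K,a) = μ_{K/N}(R_a ∩ {N↔b}) − μ_{K/N}(R_a ∩ {d↔b})` (`R_a` = some pair `N–a` open); the side condition the step needs is the RESTRICTED
comparison `μ_{K/N}({d↮N} ∩ {d↔b}) ≤ μ_{K/N}({d↮N} ∩ {a↔b})` in the glued weighting.  `fingerML3_peel` obtains it from the unglued hypothesis
(`glue_restricted_of_unglued`: Kozma–Nitzan Lemma 3(ii) in `K` with the decreasing event `{d↮N}`, pushed forward to `K/N`).  Here we record the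
second natural source: the comparison `μ_{K/N}(d↔b) ≤ μ_{K/N}(a↔b)` in the GLUED weighting itself (Lemma 3(ii) directly in `K/N`,
`glue_restricted_of_glued`), giving `fingerML3_peel_glued`.  The two sources are incomparable (gluing the block can raise `d` above `a` or `a`
above `d`), so the ∃-order peeling reductions of the depth-prover memos (MEMO-gen8 §3, MEMO-gen9 §4: at each stage the relay being detached must
dominate `d` in the current weighting, unglued OR glued) may use either at each step.
[cite: KozmaNitzan2024, Lemma 3(ii) (pp. 6–7), §3.2 pp. 12–14]
-/

namespace Summit.CriticalPhenomena.PercolationContinuityZ3.Theorems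

open MeasureTheory Set
open Literature.Probability.LatticeModels (prodBernoulli)
open Literature.Probability.Percolation (BondConfig openConn openGraph pinW)

noncomputable section
open Classical

section FingerPeelGlued

open Literature.Probability.LatticeModels Literature.Probability.Percolation

variable {n : ℕ}

/-- **Restricted comparison from the glued comparison.**  If `μ_{K/N}(d ↔ b) ≤ μ_{K/N}(a ↔ b)` in the glued weighting, then also
`μ_{K/N}({d ↮ N} ∩ {d ↔ b}) ≤ μ_{K/N}({d ↮ N} ∩ {a ↔ b})`: Kozma–Nitzan Lemma 3(ii) in `K/N` with the decreasing event `{d ↮ N}` of the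
cluster of `d`. [cite: KozmaNitzan2024, Lemma 3(ii) (pp. 6–7)] -/
theorem glue_restricted_of_glued (K : Sym2 (Fin n) → unitInterval) (N : Finset (Fin n)) (d a b : Fin n)
    (hle : (prodBernoulli (fun e' : Sym2 (Fin n) => if (∀ y ∈ e', y ∈ N) ∧ ¬ e'.IsDiag then 1 else K e')).real (openConn d b) ≤
      (prodBernoulli (fun e' : Sym2 (Fin n) => if (∀ y ∈ e', y ∈ N) ∧ ¬ e'.IsDiag then 1 else K e')).real (openConn a b)) :
    (prodBernoulli (fun e' : Sym2 (Fin n) => if (∀ y ∈ e', y ∈ N) ∧ ¬ e'.IsDiag then 1 else K e')).real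
        ({ω : BondConfig (Fin n) | ∀ x ∈ (↑N : Set (Fin n)), ¬ (openGraph ω).Reachable d x} ∩ openConn d b) ≤
      (prodBernoulli (fun e' : Sym2 (Fin n) => if (∀ y ∈ e', y ∈ N) ∧ ¬ e'.IsDiag then 1 else K e')).real
        ({ω : BondConfig (Fin n) | ∀ x ∈ (↑N : Set (Fin n)), ¬ (openGraph ω).Reachable d x} ∩ openConn a b) := by
  set g : Sym2 (Fin n) → unitInterval := fun e' => if (∀ y ∈ e', y ∈ N) ∧ ¬ e'.IsDiag then 1 else K e' with hg
  have h := KozmaNitzan2024_lemma3_ii_notConn g d a b (↑N : Set (Fin n)) hle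
  rw [Set.inter_comm (openConn d b), Set.inter_comm (openConn a b)] at h
  exact h

/-- **Peeling the contacts at one relay, glued comparison.**  Finger/stub setting with `d, a ∈ A`, `a ≠ d`.  If
`μ_{K/N}(d ↔ b) ≤ μ_{K/N}(a ↔ b)` (in the GLUED weighting) and FML3 holds for the relay set `A ∖ {a}` in the weighting `K ⊖ (N–a)` (pairs
`s(v,a)`, `v ∈ N`, killed), then FML3 holds for `A` in `K`: `μ_{K/N}(R_A ∩ {d↔b}) ≤ μ_{K/N}(R_A ∩ ⋃_{v∈N}{v↔b})`.
(`glue_restricted_of_glued` + `block_multiEdge_peel`; compare `fingerML3_peel`, whose comparison is unglued.)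
[cite: KozmaNitzan2024, Lemma 3(ii) (pp. 6–7), §3.2 pp. 12–14] -/
theorem fingerML3_peel_glued (K : Sym2 (Fin n) → unitInterval) (A N : Finset (Fin n)) (d a b : Fin n)
    (hNA : Disjoint N A) (hd : d ∈ A) (ha : a ∈ A) (hda : d ≠ a)
    (hle : (prodBernoulli (fun e' : Sym2 (Fin n) => if (∀ y ∈ e', y ∈ N) ∧ ¬ e'.IsDiag then 1 else K e')).real (openConn d b) ≤
      (prodBernoulli (fun e' : Sym2 (Fin n) => if (∀ y ∈ e', y ∈ N) ∧ ¬ e'.IsDiag then 1 else K e')).real (openConn a b))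
    (hsub : (prodBernoulli (fun e' : Sym2 (Fin n) => if (∀ y ∈ e', y ∈ N) ∧ ¬ e'.IsDiag then 1 else
              if (∃ v ∈ N, e' = s(v, a)) then (0 : unitInterval) else K e')).real
          ({ω : Set (Sym2 (Fin n)) | ∃ v ∈ N, ∃ a' ∈ A.erase a, s(v, a') ∈ ω} ∩ openConn d b) ≤
        (prodBernoulli (fun e' : Sym2 (Fin n) => if (∀ y ∈ e', y ∈ N) ∧ ¬ e'.IsDiag then 1 else
              if (∃ v ∈ N, e' = s(v, a)) then (0 : unitInterval) else K e')).real
          ({ω : Set (Sym2 (Fin n)) | ∃ v ∈ N, ∃ a' ∈ A.erase a, s(v, a') ∈ ω} ∩ ⋃ v ∈ N, openConn v b)) :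
    (prodBernoulli (fun e' : Sym2 (Fin n) => if (∀ y ∈ e', y ∈ N) ∧ ¬ e'.IsDiag then 1 else K e')).real
        ({ω : Set (Sym2 (Fin n)) | ∃ v ∈ N, ∃ a' ∈ A, s(v, a') ∈ ω} ∩ openConn d b) ≤
      (prodBernoulli (fun e' : Sym2 (Fin n) => if (∀ y ∈ e', y ∈ N) ∧ ¬ e'.IsDiag then 1 else K e')).real
        ({ω : Set (Sym2 (Fin n)) | ∃ v ∈ N, ∃ a' ∈ A, s(v, a') ∈ ω} ∩ ⋃ v ∈ N, openConn v b) := by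
  set g : Sym2 (Fin n) → unitInterval := fun e' => if (∀ y ∈ e', y ∈ N) ∧ ¬ e'.IsDiag then 1 else K e' with hg
  set Fa : Finset (Sym2 (Fin n)) := N.image (fun v => s(v, a)) with hFadef
  set F₁ : Finset (Sym2 (Fin n)) := (N ×ˢ A.erase a).image (fun va : Fin n × Fin n => s(va.1, va.2)) with hF₁def
  have haN : a ∉ N := Finset.disjoint_left.1 hNA.symm ha
  have hdN : d ∉ N := Finset.disjoint_left.1 hNA.symm hd
  have hFa : ∀ e ∈ Fa, ∃ v ∈ N, e = s(v, a) := by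
    intro e he
    obtain ⟨v, hv, rfl⟩ := Finset.mem_image.1 he
    exact ⟨v, hv, rfl⟩
  have hrestr := glue_restricted_of_glued K N d a b hle
  have hpin := fingerPeel_pinW_glue_eq K N haN
  have hii : (prodBernoulli (pinW g (↑Fa : Set (Sym2 (Fin n))) (∅ : Set (Sym2 (Fin n))))).real
        ({ω : Set (Sym2 (Fin n)) | ∃ e ∈ F₁, e ∈ ω} ∩ openConn d b) ≤
      (prodBernoulli (pinW g (↑Fa : Set (Sym2 (Fin n))) (∅ : Set (Sym2 (Fin n))))).real
        ({ω : Set (Sym2 (Fin n)) | ∃ e ∈ F₁, e ∈ ω} ∩ ⋃ s ∈ N, openConn s b) := by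
    rw [hpin, ← fingerContact_R_eq N (A.erase a)]
    exact hsub
  rw [fingerContact_R_eq_union N A ha]
  exact block_multiEdge_peel g N F₁ Fa a d b hFa haN hdN hda hrestr hii

end FingerPeelGlued

end

end Summit.CriticalPhenomena.PercolationContinuityZ3.Theorems
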